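import Literature.NumberTheory.EllipticCurves.CongruentNumberCurveQuartic
import Literature.NumberTheory.EllipticCurves.CongruentNumberCurveSupersingular
import Literature.NumberTheory.QuadraticFields.GaussianPrimary
import Mathlib.NumberTheory.JacobiSum.Basic
import Mathlib.NumberTheory.LegendreSymbol.QuadraticChar.Basic
import Mathlib.Analysis.SpecialFunctions.Complex.CircleAddChar
import Mathlib.RingTheory.Ideal.Quotient.Operations
import HarnessLib

/-!
# Ireland–Rosen's Theorem 18.5(ii): `#E(𝔽_p)` for `y² = x³ - Dx` at `p ≡ 1 (mod 4)` via Jacobi sums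

Sibling proof file of `Literature.NumberTheory.EllipticCurves.CongruentNumberCurveSupersingular`:
it **discharges the named fact `Literature.NumberTheory.EllipticCurves.IrelandRosen1990_card_points_one_mod_four`** (Ireland–Rosen,
*A Classical Introduction to Modern Number Theory*, Ch. 18 §4, Theorem 5, second assertion:
for `p ≡ 1 (4)`, `p ∤ D`, `p = π π̄`, `π ≡ 1 (2 + 2i)`,
`N_p = p + 1 - \overline{(D/π)₄} π - (D/π)₄ π̄`) as
`Literature.NumberTheory.EllipticCurves.IrelandRosen1990_card_points_one_mod_four_holds`, following the printed proof
(PDF pp. 300–301 and Ch. 9 §9, PDF pp. 130–131). This was the last named-fact input of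
`Literature.NumberTheory.EllipticCurves.hasEntireLFunction_congruentNumberCurve` at the split primes
(`CongruentNumberCurveHeckeSeries.hasEntireLFunction_congruentNumberCurve_of_card_points`).
Everything here is proved (Mathlib's Jacobi and Gauss sums, the tree's `GaussianPrimary` and
`CongruentNumberCurveQuartic`).

## Content (namespace `Literature.GaussianQuartic`; `p ≡ 1 (4)` prime, `π ∈ ℤ[i]`, `N(π) = p`)

* `red hπp : ℤ[i] →+* ZMod p` — the reduction map `x + yi ↦ x + y ι`, `ι = -a/b` for `π = a + bi`
  (`iota`, `ι² = -1`), with `red π = 0`, **kernel `(π)`** (`dvd_of_red_eq_zero`, Euclidean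
  division) and injectivity on the units `{±1, ±i}` (`red_injOn_units`); Ireland–Rosen
  Prop. 9.8.1 (`ℤ[i]/π ≅ 𝔽_p`).
* `chi hp1 hπp : MulChar (ZMod p) ℤ[i]` — **the quartic residue character `χ_π`**: `χ_π(t)` is the
  unit `u ∈ {1, i, -1, -i}` with `φ_π(u) = t^{(p-1)/4}` (`red_chi`; Prop. 9.8.2 and the Definition
  of `(·/π)₄`, PDF p. 129); `χ_π⁴ = 1`, `χ_π² = (·/p)` (`chi_mul_chi`, `chi_sq_eq_rho`), `χ_π` has
  order `4` (`exists_chi_eq_I`), `χ_π(-4) = 1` (`-4 = (1+i)⁴`; `chi_neg_four`), and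
  `χ_π(D̄) = i^k` under the fact's hypothesis `π ∣ D^{(p-1)/4} - i^k` (`chi_intCast_eq_I_pow`).
* Counting: `#{v : v⁴ = w} = ∑_{k<4} χ_π(w)^k` (`card_pow_four_eq`, Prop. 8.1.5) and
  **eq. (i) of Ch. 18 §4**: `#{(u,v) : u² = v⁴ + c} = p - 1 + T + T̄`,
  `T = \overline{χ_π(-c)} J(χ_π, ρ)`, `ρ` the quadratic character (`card_quartic`).
* Gauss sums (in `ℂ`, Mathlib's `jacobiSum_mul_nontrivial`, `gaussSum_sq`,
  `gaussSum_mul_gaussSum_eq_card`, `jacobiSum_mul_jacobiSum_inv`): **`J(χ_π, ρ) = χ_π(-1) J(χ_π, χ_π)`**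
  (`jacobiSum_chi_rho`, Prop. 9.9.1) and `N(J(χ_π, χ_π)) = p` (`norm_jacobiSum_chi_chi`).
* **Prop. 9.9.3–9.9.4**: `π ∣ J(χ_π, χ_π)` (`dvd_jacobiSum_chi_chi`: the power sums `∑_t t^e`,
  `e < p - 1`, vanish), `-χ_π(-1) J(χ_π, χ_π)` is primary (`isPrimary_neg_mul_jacobiSum`: the
  pairing `t ↔ 1 - t` modulo `(2 + 2i)`, done in `ℤ[i]/(2+2i)`), hence `= π` for `π` primary
  (`neg_mul_jacobiSum_eq`) and `J(χ_π, ρ) = -π` (`jacobiSum_chi_rho_eq`).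
* `Literature.NumberTheory.EllipticCurves.IrelandRosen1990_card_points_one_mod_four_holds` — the assembly with
  `IrelandRosen1990_card_points_eq_card_quartic_add_two` (`N_p = N(u² = v⁴ + 4D) + 2`) and
  `χ_π(-4D) = χ_π(D) = i^k`.

## References

* K. Ireland, M. Rosen, *A Classical Introduction to Modern Number Theory*, 2nd ed., GTM 84
  (1990): Ch. 8 §3 Thm. 1 and Prop. 8.1.5; Ch. 9 §7 Lemmas 6–7 (PDF p. 128), §8 Props. 9.8.1–9.8.2
  and Definition (PDF pp. 128–129), §9 Props. 9.9.1–9.9.4 (PDF pp. 130–131); Ch. 18 §4 Theorem 5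
  and its proof, eq. (i) (PDF pp. 300–301) — held, read via
  `lit read book:ireland1982-classical-introduction-modern-number-theory`.
-/

noncomputable section

open scoped Classical

namespace Literature.NumberTheory.EllipticCurves

namespace GaussianQuartic

local notation "ℤ[i]" => GaussianInt

open Zsqrtd QuadraticFields.GaussianPrimary

variable {p : ℕ} [hp : Fact p.Prime]

/-! ### The reduction map `ℤ[i] → 𝔽_p` attached to `π`, `N(π) = p` -/

section Reduction

variable {π : ℤ[i]}

/-- A prime `p ≡ 1 (mod 4)` is at least `5`. [folklore] -/
theorem five_le (hp1 : p % 4 = 1) : 5 ≤ p := by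
  have h2 := hp.out.two_le
  by_contra h
  interval_cases p <;> omega

/-- `p ∤ im π` when `N(π) = p`. [folklore] -/
theorem im_ne_zero (hπp : π.norm = p) : ((π.im : ℤ) : ZMod p) ≠ 0 := by
  intro h
  rw [ZMod.intCast_zmod_eq_zero_iff_dvd] at h
  have hn : (p : ℤ) = π.re * π.re + π.im * π.im := by
    rw [← hπp, Zsqrtd.norm_def]; ring
  have hre : (p : ℤ) ∣ π.re * π.re := by
    have h2 : (p : ℤ) ∣ π.re * π.re + π.im * π.im := ⟨1, by rw [← hn, mul_one]⟩
    exact (Int.dvd_add_left (h.mul_right _)).mp h2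
  have hre' : (p : ℤ) ∣ π.re := (Int.Prime.dvd_mul' hp.out hre).elim id id
  obtain ⟨c, hc⟩ := hre'
  obtain ⟨d, hd⟩ := h
  have h0 : (p : ℤ) = p * (p * (c * c + d * d)) := by
    conv_lhs => rw [hn]
    rw [hc, hd]; ring
  have hp0 : (p : ℤ) ≠ 0 := by exact_mod_cast hp.out.ne_zero
  have h1 : (1 : ℤ) = p * (c * c + d * d) := by
    apply mul_left_cancel₀ hp0
    rw [mul_one]
    exact h0
  have hp2 : (2 : ℤ) ≤ p := by exact_mod_cast hp.out.two_le
  have hs : 0 ≤ c * c + d * d := add_nonneg (mul_self_nonneg c) (mul_self_nonneg d)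
  rcases hs.eq_or_lt with h0' | h0'
  · rw [← h0', mul_zero] at h1; exact one_ne_zero h1
  · nlinarith

/-- The square root of `-1` in `𝔽_p` attached to `π = a + b i`: `ι = -a/b`. [folklore] -/
def iota (π : ℤ[i]) : ZMod p := -((π.re : ℤ) : ZMod p) * ((π.im : ℤ) : ZMod p)⁻¹

/-- `ι² = -1`. [folklore] -/
theorem iota_mul_iota (hπp : π.norm = p) : iota (p := p) π * iota π = ((-1 : ℤ) : ZMod p) := by
  have hb := im_ne_zero hπp
  have hn : ((π.re : ℤ) : ZMod p) * ((π.re : ℤ) : ZMod p) +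
      ((π.im : ℤ) : ZMod p) * ((π.im : ℤ) : ZMod p) = 0 := by
    have : ((p : ℤ) : ZMod p) = ((π.re * π.re + π.im * π.im : ℤ) : ZMod p) := by
      rw [← hπp, Zsqrtd.norm_def]; push_cast; ring
    rw [Int.cast_natCast, ZMod.natCast_self] at this
    push_cast at this
    exact this.symm
  unfold iota
  field_simp
  rw [Int.cast_neg, Int.cast_one]
  linear_combination hn

/-- `ι² = -1` (numeral form). [folklore] -/
theorem iota_sq (hπp : π.norm = p) : iota (p := p) π * iota π = -1 := by
  have := iota_mul_iota hπp
  rwa [Int.cast_neg, Int.cast_one] at this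

/-- The reduction map `φ_π : ℤ[i] →+* 𝔽_p`, `x + y i ↦ x + y ι`. [folklore] -/
def red (hπp : π.norm = p) : ℤ[i] →+* ZMod p := Zsqrtd.lift ⟨iota π, iota_mul_iota hπp⟩

/-- `φ_π(x + yi) = x + y ι`. [folklore] -/
theorem red_apply (hπp : π.norm = p) (x : ℤ[i]) :
    red hπp x = (x.re : ZMod p) + (x.im : ZMod p) * iota π := by
  simp [red]

/-- `φ_π(π) = 0`. [folklore] -/
theorem red_self (hπp : π.norm = p) : red hπp π = 0 := by
  rw [red_apply]
  unfold iota
  have hb := im_ne_zero hπp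
  field_simp
  ring

/-- `π ≠ 0`. [folklore] -/
theorem ne_zero_of_norm (hπp : π.norm = p) : π ≠ 0 := by
  rw [← GaussianInt.norm_pos, hπp]; exact_mod_cast hp.out.pos

/-- **The kernel of `φ_π` is `(π)`**: `φ_π(x) = 0 → π ∣ x` (Euclidean division by `π`; a
remainder `c + di` with `c + d ι = 0` has `p ∣ c² + d² < p`). [folklore] -/
theorem dvd_of_red_eq_zero (hπp : π.norm = p) {x : ℤ[i]} (hx : red hπp x = 0) : π ∣ x := by
  have hπ0 := ne_zero_of_norm hπp
  set r := x % π with hr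
  have hdiv : x = π * (x / π) + r := (EuclideanDomain.div_add_mod x π).symm
  have hr0 : red hπp r = 0 := by
    have := congrArg (red hπp) hdiv
    rw [map_add, map_mul, red_self hπp, zero_mul, zero_add] at this
    rw [← this, hx]
  have hnorm : r.norm < p := by rw [← hπp]; exact GaussianInt.norm_mod_lt x hπ0
  have hcd : ((r.norm : ℤ) : ZMod p) = 0 := by
    rw [red_apply] at hr0
    have h1 : (r.re : ZMod p) = -(r.im : ZMod p) * iota π := by linear_combination hr0
    have : ((r.norm : ℤ) : ZMod p) = (r.re : ZMod p) * (r.re : ZMod p) +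
        (r.im : ZMod p) * (r.im : ZMod p) := by
      rw [Zsqrtd.norm_def]; push_cast; ring
    rw [this, h1]
    linear_combination (r.im : ZMod p) * (r.im : ZMod p) * iota_sq hπp
  rw [ZMod.intCast_zmod_eq_zero_iff_dvd] at hcd
  have hr00 : r.norm = 0 := by
    have h0 := GaussianInt.norm_nonneg r
    rcases h0.eq_or_lt with h | h
    · exact h.symm
    · exact absurd (Int.le_of_dvd h hcd) (not_le.mpr hnorm)
  rw [GaussianInt.norm_eq_zero] at hr00
  rw [hdiv, hr00, add_zero]
  exact dvd_mul_right π _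

/-- Differences of distinct units of `ℤ[i]` have norm at most `4`. [folklore] -/
theorem norm_sub_le_four {u u' : ℤ[i]} (hu : IsUnit u) (hu' : IsUnit u') : (u - u').norm ≤ 4 := by
  rcases eq_of_isUnit hu with rfl | rfl | rfl | rfl <;>
    rcases eq_of_isUnit hu' with rfl | rfl | rfl | rfl <;> decide

/-- **`φ_π` is injective on the units `{1, i, -1, -i}`** (their differences have norm `≤ 4 < p`).
[folklore] -/
theorem red_injOn_units (hp1 : p % 4 = 1) (hπp : π.norm = p) {u u' : ℤ[i]} (hu : IsUnit u)
    (hu' : IsUnit u') (h : red hπp u = red hπp u') : u = u' := by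
  by_contra hne
  have hd : π ∣ u - u' := dvd_of_red_eq_zero hπp (by rw [map_sub, h, sub_self])
  have hN := norm_dvd_norm hd
  rw [hπp] at hN
  have hpos : 0 < (u - u').norm := GaussianInt.norm_pos.mpr (sub_ne_zero.mpr hne)
  have hle := Int.le_of_dvd hpos hN
  have h4 := norm_sub_le_four hu hu'
  have h5 : (5 : ℤ) ≤ p := by exact_mod_cast five_le hp1
  omega

/-- `ι ≠ ± 1`, i.e. `φ_π(i) ≠ φ_π(±1)`. [folklore] -/
theorem iota_ne (hp1 : p % 4 = 1) (hπp : π.norm = p) : iota (p := p) π ≠ 1 ∧ iota (p := p) π ≠ -1 := by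
  have h1 : red hπp ⟨0, 1⟩ = iota π := by rw [red_apply]; simp
  constructor
  · intro h
    have := red_injOn_units hp1 hπp isUnit_I isUnit_one (by rw [h1, h, map_one])
    exact absurd this (by decide)
  · intro h
    have := red_injOn_units hp1 hπp isUnit_I isUnit_one.neg (by rw [h1, h, map_neg, map_one])
    exact absurd this (by decide)

end Reduction

/-! ### The quartic residue character `χ_π` on `𝔽_p` with values in `ℤ[i]` -/

section Character

variable {π : ℤ[i]}

omit hp in
/-- `4 · (p/4) = p - 1` and `2 · (p/4) = p/2` for `p ≡ 1 (mod 4)`. [folklore] -/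
theorem four_mul_div_four (hp1 : p % 4 = 1) : 4 * (p / 4) = p - 1 ∧ 2 * (p / 4) = p / 2 := by
  omega

/-- For `t ≠ 0`, `t^{(p-1)/4}` is one of `1, ι, -1, -ι`. [folklore] -/
theorem pow_div_four_mem (hp1 : p % 4 = 1) (hπp : π.norm = p) {t : ZMod p} (ht : t ≠ 0) :
    t ^ (p / 4) = 1 ∨ t ^ (p / 4) = iota π ∨ t ^ (p / 4) = -1 ∨ t ^ (p / 4) = -iota π := by
  set ζ := t ^ (p / 4) with hζ
  have h4 : (ζ * ζ) * (ζ * ζ) = 1 := by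
    rw [hζ, ← pow_add, ← pow_add, show p / 4 + p / 4 + (p / 4 + p / 4) = p - 1 by omega]
    exact ZMod.pow_card_sub_one_eq_one ht
  rcases mul_self_eq_one_iff.mp h4 with h2 | h2
  · rcases mul_self_eq_one_iff.mp h2 with h1 | h1
    · exact Or.inl h1
    · exact Or.inr (Or.inr (Or.inl h1))
  · rw [← iota_sq hπp] at h2
    rcases mul_self_eq_mul_self_iff.mp h2 with h1 | h1
    · exact Or.inr (Or.inl h1)
    · exact Or.inr (Or.inr (Or.inr h1))

/-- The values of `χ_π`: `χ_π(t) ∈ {1, i, -1, -i}` is the unit `u` with `φ_π(u) = t^{(p-1)/4}`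
(Ireland–Rosen, Ch. 9 §8, Prop. 9.8.2 and the Definition of the quartic residue character:
`χ_π(α) = i^j` where `α^{(N π - 1)/4} ≡ i^j (π)`), and `χ_π(0) = 0`. [folklore] -/
def chiFun (π : ℤ[i]) (t : ZMod p) : ℤ[i] :=
  if t = 0 then 0 else if t ^ (p / 4) = 1 then 1 else if t ^ (p / 4) = iota π then ⟨0, 1⟩
  else if t ^ (p / 4) = -1 then -1 else -⟨0, 1⟩

/-- `χ_π(0) = 0`. [folklore] -/
@[simp] theorem chiFun_zero : chiFun (p := p) π 0 = 0 := if_pos rfl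

/-- **Defining property of `χ_π`: `φ_π(χ_π(t)) = t^{(p-1)/4}`** for `t ≠ 0`. [folklore] -/
theorem red_chiFun (hp1 : p % 4 = 1) (hπp : π.norm = p) {t : ZMod p} (ht : t ≠ 0) :
    red hπp (chiFun π t) = t ^ (p / 4) := by
  unfold chiFun
  rw [if_neg ht]
  split_ifs with h1 h2 h3
  · rw [map_one, h1]
  · rw [red_apply, h2]; simp
  · rw [map_neg, map_one, h3]
  · rcases pow_div_four_mem hp1 hπp ht with h | h | h | h
    · exact absurd h h1
    · exact absurd h h2
    · exact absurd h h3
    · rw [map_neg, red_apply, h]; simp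

/-- `χ_π(t)` is a unit for `t ≠ 0`. [folklore] -/
theorem isUnit_chiFun {t : ZMod p} (ht : t ≠ 0) : IsUnit (chiFun (p := p) π t) := by
  unfold chiFun
  rw [if_neg ht]
  split_ifs
  exacts [isUnit_one, isUnit_I, isUnit_one.neg, isUnit_I.neg]

/-- `χ_π(1) = 1`. [folklore] -/
theorem chiFun_one : chiFun (p := p) π 1 = 1 := by
  unfold chiFun
  rw [if_neg one_ne_zero, if_pos (one_pow _)]

/-- **`χ_π` is multiplicative.** [folklore] -/
theorem chiFun_mul (hp1 : p % 4 = 1) (hπp : π.norm = p) (s t : ZMod p) :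
    chiFun π (s * t) = chiFun π s * chiFun π t := by
  rcases eq_or_ne s 0 with rfl | hs
  · simp
  rcases eq_or_ne t 0 with rfl | ht
  · simp
  refine red_injOn_units hp1 hπp (isUnit_chiFun (mul_ne_zero hs ht))
    ((isUnit_chiFun hs).mul (isUnit_chiFun ht)) ?_
  rw [map_mul, red_chiFun hp1 hπp (mul_ne_zero hs ht), red_chiFun hp1 hπp hs,
    red_chiFun hp1 hπp ht, mul_pow]

/-- **The quartic residue character `χ_π : 𝔽_p → ℤ[i]`** as a multiplicative character
(Ireland–Rosen, Ch. 9 §8–§9: "`χ_π` may be viewed as a multiplicative character on the finite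
field `D/πD`"). [folklore] -/
def chi (hp1 : p % 4 = 1) (hπp : π.norm = p) : MulChar (ZMod p) ℤ[i] where
  toFun := chiFun π
  map_one' := chiFun_one
  map_mul' := chiFun_mul hp1 hπp
  map_nonunit' a ha := by
    have : a = 0 := by
      by_contra h
      exact ha (isUnit_iff_ne_zero.mpr h)
    rw [this]; exact chiFun_zero

/-- `χ_π(t) = chiFun π t`. [folklore] -/
theorem chi_apply (hp1 : p % 4 = 1) (hπp : π.norm = p) (t : ZMod p) :
    chi hp1 hπp t = chiFun π t := rfl

/-- `φ_π(χ_π(t)) = t^{(p-1)/4}` for `t ≠ 0`. [folklore] -/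
theorem red_chi (hp1 : p % 4 = 1) (hπp : π.norm = p) {t : ZMod p} (ht : t ≠ 0) :
    red hπp (chi hp1 hπp t) = t ^ (p / 4) :=
  red_chiFun hp1 hπp ht

/-- `χ_π(t)` is a unit for `t ≠ 0`. [folklore] -/
theorem isUnit_chi (hp1 : p % 4 = 1) (hπp : π.norm = p) {t : ZMod p} (ht : t ≠ 0) :
    IsUnit (chi hp1 hπp t) :=
  isUnit_chiFun ht

/-- **`χ_π(t) = u ↔ φ_π(u) = t^{(p-1)/4}`** for a unit `u` and `t ≠ 0`. [folklore] -/
theorem chi_eq_iff (hp1 : p % 4 = 1) (hπp : π.norm = p) {t : ZMod p} (ht : t ≠ 0) {u : ℤ[i]}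
    (hu : IsUnit u) : chi hp1 hπp t = u ↔ red hπp u = t ^ (p / 4) := by
  constructor
  · rintro rfl; exact red_chi hp1 hπp ht
  · intro h
    exact red_injOn_units hp1 hπp (isUnit_chi hp1 hπp ht) hu (by rw [red_chi hp1 hπp ht, h])

/-- `χ_π` takes values in `{0, 1, i, -1, -i}`, so `χ_π(t)⁴ = 1` for `t ≠ 0`. [folklore] -/
theorem chi_pow_four (hp1 : p % 4 = 1) (hπp : π.norm = p) {t : ZMod p} (ht : t ≠ 0) :
    chi hp1 hπp t ^ 4 = 1 := by
  rcases eq_of_isUnit (isUnit_chi hp1 hπp ht) with h | h | h | h <;> rw [h] <;> decide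

/-- `star χ_π(t) = χ_π(t)³` (complex conjugation inverts roots of unity). [folklore] -/
theorem star_chi (hp1 : p % 4 = 1) (hπp : π.norm = p) (t : ZMod p) :
    star (chi hp1 hπp t) = chi hp1 hπp t ^ 3 := by
  rcases eq_or_ne t 0 with rfl | ht
  · rw [MulChar.map_zero]; simp
  rcases eq_of_isUnit (isUnit_chi hp1 hπp ht) with h | h | h | h <;> rw [h] <;> decide

/-- **`χ_π(-4) = 1`**: `-4 = (1 + i)⁴` is a fourth power modulo `π` (Ireland–Rosen, proof of
Prop. 9.9.3: `χ_π(2) = χ_π(-i(1+i)²)`). [folklore] -/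
theorem chi_neg_four (hp1 : p % 4 = 1) (hπp : π.norm = p) : chi hp1 hπp (-4) = 1 := by
  set w : ZMod p := red hπp ⟨1, 1⟩ with hw
  have hw0 : w ≠ 0 := by
    rw [hw, red_apply]
    simp only [Int.cast_one, one_mul]
    intro h
    exact (iota_ne hp1 hπp).2 (by linear_combination h)
  have hw4 : w ^ 4 = -4 := by
    rw [hw, ← map_pow, show (⟨1, 1⟩ : ℤ[i]) ^ 4 = -4 by decide, map_neg, map_ofNat]
  have h4 : (-4 : ZMod p) ≠ 0 := by rw [← hw4]; exact pow_ne_zero 4 hw0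
  rw [chi_eq_iff hp1 hπp h4 isUnit_one, map_one, ← hw4, ← pow_mul, (four_mul_div_four hp1).1]
  exact (ZMod.pow_card_sub_one_eq_one hw0).symm

/-- `χ_π(-1) = χ_π(4)` (from `χ_π(-4) = 1` and `χ_π(-1)² = 1`). [folklore] -/
theorem chi_neg_one_eq_chi_four (hp1 : p % 4 = 1) (hπp : π.norm = p) :
    chi hp1 hπp (-1) = chi hp1 hπp 4 := by
  have h := chi_neg_four hp1 hπp
  rw [show (-4 : ZMod p) = -1 * 4 by ring, map_mul] at h
  have h1 : chi hp1 hπp (-1) * chi hp1 hπp (-1) = 1 := by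
    rw [← map_mul, neg_one_mul, neg_neg, map_one]
  calc chi hp1 hπp (-1) = chi hp1 hπp (-1) * (chi hp1 hπp (-1) * chi hp1 hπp 4) := by
        rw [h, mul_one]
    _ = chi hp1 hπp 4 := by rw [← mul_assoc, h1, one_mul]

/-- `χ_π(-1) = ±1`. [folklore] -/
theorem chi_neg_one_sq (hp1 : p % 4 = 1) (hπp : π.norm = p) :
    chi hp1 hπp (-1) * chi hp1 hπp (-1) = 1 := by
  rw [← map_mul, neg_one_mul, neg_neg, map_one]

/-- **`χ_π(D̄) = i^k` when `π ∣ D^{(p-1)/4} - i^k`** (the hypothesis form of the named fact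
`IrelandRosen1990_card_points_one_mod_four`; Ireland–Rosen, Definition of `(D/π)₄`). [folklore] -/
theorem chi_intCast_eq_I_pow (hp1 : p % 4 = 1) (hπp : π.norm = p) {D : ℤ} (hD : ¬ (p : ℤ) ∣ D)
    {k : ℕ} (h : π ∣ (D : ℤ[i]) ^ ((p - 1) / 4) - ⟨0, 1⟩ ^ k) :
    chi hp1 hπp (D : ZMod p) = ⟨0, 1⟩ ^ k := by
  have hD0 : ((D : ℤ) : ZMod p) ≠ 0 := by
    rwa [Ne, ZMod.intCast_zmod_eq_zero_iff_dvd]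
  rw [chi_eq_iff hp1 hπp hD0 (isUnit_I.pow k)]
  obtain ⟨c, hc⟩ := h
  have := congrArg (red hπp) hc
  rw [map_mul, red_self hπp, zero_mul, map_sub, sub_eq_zero, map_pow, map_intCast,
    show (p - 1) / 4 = p / 4 by omega] at this
  exact this.symm

/-- **`χ_π` has order `4`**: some `t` has `χ_π(t) = i` (a generator `g` of `𝔽_p^×` has
`g^{(p-1)/4} = ±ι`). [folklore] -/
theorem exists_chi_eq_I (hp1 : p % 4 = 1) (hπp : π.norm = p) : ∃ t : ZMod p, chi hp1 hπp t = ⟨0, 1⟩ := by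
  obtain ⟨g, hg⟩ := IsCyclic.exists_generator (α := (ZMod p)ˣ)
  have horder : orderOf g = p - 1 := by
    rw [orderOf_eq_card_of_forall_mem_zpowers hg, Nat.card_eq_fintype_card, ZMod.card_units p]
  have hg0 : (g : ZMod p) ≠ 0 := g.ne_zero
  have h5 := five_le hp1
  have hζ2 : (g : ZMod p) ^ (p / 4) * (g : ZMod p) ^ (p / 4) ≠ 1 := by
    intro h
    rw [← pow_add] at h
    have h' : g ^ (p / 4 + p / 4) = 1 := by
      ext; rw [Units.val_pow_eq_pow_val, h, Units.val_one]
    have hdvd := orderOf_dvd_of_pow_eq_one h'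
    rw [horder] at hdvd
    have := Nat.le_of_dvd (by omega) hdvd
    omega
  have hred : red hπp ⟨0, 1⟩ = iota π := by rw [red_apply]; simp
  rcases pow_div_four_mem hp1 hπp hg0 with h | h | h | h
  · exact absurd (by rw [h, mul_one]) hζ2
  · exact ⟨g, (chi_eq_iff hp1 hπp hg0 isUnit_I).mpr (by rw [hred, ← h])⟩
  · exact absurd (by rw [h]; ring) hζ2
  · refine ⟨(g : ZMod p) ^ 3, (chi_eq_iff hp1 hπp (pow_ne_zero 3 hg0) isUnit_I).mpr ?_⟩
    rw [hred, ← pow_mul, mul_comm, pow_mul, h]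
    have hi := iota_sq hπp
    linear_combination (iota π) * hi

/-- **`χ_π² = (·/p)`**: `χ_π(t)² = ±1` is the Legendre symbol (`φ_π(χ_π(t)²) = t^{(p-1)/2}`,
Euler's criterion; Ireland–Rosen Ch. 9 §9: "`ψ = χ_π²` … is the Legendre symbol"). [folklore] -/
theorem chi_mul_chi (hp1 : p % 4 = 1) (hπp : π.norm = p) (t : ZMod p) :
    chi hp1 hπp t * chi hp1 hπp t = ((quadraticChar (ZMod p) t : ℤ) : ℤ[i]) := by
  rcases eq_or_ne t 0 with rfl | ht
  · simp [MulChar.map_zero]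
  have hchar : ringChar (ZMod p) ≠ 2 := by
    rw [ZMod.ringChar_zmod_n]; intro h; rw [h] at hp1; norm_num at hp1
  have hq : IsUnit ((quadraticChar (ZMod p) t : ℤ) : ℤ[i]) := by
    rw [quadraticChar_eq_pow_of_char_ne_two hchar ht]
    split_ifs
    · simp
    · simp
  refine red_injOn_units hp1 hπp ((isUnit_chi hp1 hπp ht).mul (isUnit_chi hp1 hπp ht)) hq ?_
  rw [map_mul, red_chi hp1 hπp ht, ← pow_add, map_intCast,
    show p / 4 + p / 4 = p / 2 by omega]
  have := quadraticChar_eq_pow_of_char_ne_two' hchar t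
  rw [ZMod.card p] at this
  exact this.symm

end Character

/-! ### Counting points: `#{v : v⁴ = w}` and `#{(u, v) : u² = v⁴ + c}` -/

section Counting

variable {π : ℤ[i]}

/-- The fourth roots of unity in `𝔽_p` are `1, ι, -1, -ι`. [folklore] -/
theorem fourth_root_of_unity (hπp : π.norm = p) {ζ : ZMod p} (h : ζ ^ 4 = 1) :
    ζ = 1 ∨ ζ = iota π ∨ ζ = -1 ∨ ζ = -iota π := by
  have h4 : (ζ * ζ) * (ζ * ζ) = 1 := by rw [← h]; ring
  rcases mul_self_eq_one_iff.mp h4 with h2 | h2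
  · rcases mul_self_eq_one_iff.mp h2 with h1 | h1
    · exact Or.inl h1
    · exact Or.inr (Or.inr (Or.inl h1))
  · rw [← iota_sq hπp] at h2
    rcases mul_self_eq_mul_self_iff.mp h2 with h1 | h1
    · exact Or.inr (Or.inl h1)
    · exact Or.inr (Or.inr (Or.inr h1))

/-- **`χ_π(t) = 1 ↔ t` is a fourth power** (`t ≠ 0`; `𝔽_p^×` is cyclic of order `4 · (p-1)/4`).
[folklore] -/
theorem chi_eq_one_iff (hp1 : p % 4 = 1) (hπp : π.norm = p) {t : ZMod p} (ht : t ≠ 0) :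
    chi hp1 hπp t = 1 ↔ ∃ a : ZMod p, a ^ 4 = t := by
  constructor
  · intro h
    rw [chi_eq_iff hp1 hπp ht isUnit_one, map_one] at h
    obtain ⟨g, hg⟩ := IsCyclic.exists_generator (α := (ZMod p)ˣ)
    have horder : orderOf g = p - 1 := by
      rw [orderOf_eq_card_of_forall_mem_zpowers hg, Nat.card_eq_fintype_card, ZMod.card_units p]
    obtain ⟨e, he⟩ := Subgroup.mem_zpowers_iff.mp (hg (Units.mk0 t ht))
    have hpow : (g ^ e) ^ ((p / 4 : ℕ) : ℤ) = 1 := by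
      rw [he]
      ext
      rw [zpow_natCast, Units.val_pow_eq_pow_val, Units.val_mk0, ← h, Units.val_one]
    rw [← zpow_mul, ← orderOf_dvd_iff_zpow_eq_one, horder] at hpow
    have h4 : ((p - 1 : ℕ) : ℤ) = 4 * ((p / 4 : ℕ) : ℤ) := by
      rw [← (four_mul_div_four hp1).1]; push_cast; ring
    rw [h4] at hpow
    obtain ⟨c, hc⟩ := hpow
    have hm0 : ((p / 4 : ℕ) : ℤ) ≠ 0 := by
      have := five_le hp1; exact_mod_cast (show p / 4 ≠ 0 by omega)
    have he4 : e = 4 * c := by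
      have : ((p / 4 : ℕ) : ℤ) * e = ((p / 4 : ℕ) : ℤ) * (4 * c) := by linear_combination hc
      exact mul_left_cancel₀ hm0 this
    refine ⟨((g ^ c : (ZMod p)ˣ) : ZMod p), ?_⟩
    rw [← Units.val_pow_eq_pow_val, ← zpow_natCast, ← zpow_mul, Nat.cast_ofNat,
      mul_comm, ← he4, he, Units.val_mk0]
  · rintro ⟨a, rfl⟩
    have ha : a ≠ 0 := fun h ↦ ht (by rw [h]; ring)
    rw [map_pow, chi_pow_four hp1 hπp ha]

/-- `2 ≠ 0` in `𝔽_p` for `p ≡ 1 (mod 4)`. [folklore] -/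
theorem two_ne_zero_of_one_mod_four (hp1 : p % 4 = 1) : (2 : ZMod p) ≠ 0 := by
  intro h
  have := (ZMod.natCast_eq_zero_iff 2 p).mp (by exact_mod_cast h)
  have := Nat.le_of_dvd two_pos this
  have := five_le hp1
  omega

/-- The four fourth roots of unity are distinct. [folklore] -/
theorem card_fourth_roots_of_unity (hp1 : p % 4 = 1) (hπp : π.norm = p) :
    ({1, iota π, -1, -iota π} : Finset (ZMod p)).card = 4 := by
  obtain ⟨h1, h1'⟩ := iota_ne hp1 hπp
  have h2 := two_ne_zero_of_one_mod_four (p := p) hp1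
  have hι0 : iota (p := p) π ≠ 0 := by
    intro h; have := iota_sq hπp; rw [h, mul_zero] at this
    exact one_ne_zero (by linear_combination this)
  rw [Finset.card_insert_of_notMem, Finset.card_insert_of_notMem, Finset.card_pair]
  · exact fun h ↦ h1 (neg_injective h).symm
  · simp only [Finset.mem_insert, Finset.mem_singleton, not_or]
    refine ⟨h1', fun h ↦ hι0 ?_⟩
    have : (2 : ZMod p) * iota π = 0 := by linear_combination h
    exact (mul_eq_zero.mp this).resolve_left h2
  · simp only [Finset.mem_insert, Finset.mem_singleton, not_or]
    exact ⟨fun h ↦ h1 h.symm, fun h ↦ h2 (by linear_combination h),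
      fun h ↦ h1' (by linear_combination h)⟩

/-- **`#{v : v⁴ = w} = 1 + χ_π(w) + χ_π(w)² + χ_π(w)³`** (Ireland–Rosen, Prop. 8.1.5:
`N(xⁿ = a) = ∑_{χⁿ = ε} χ(a)`, here with `χ_π(0) = 0`). [folklore] -/
theorem card_pow_four_eq (hp1 : p % 4 = 1) (hπp : π.norm = p) (w : ZMod p) :
    (((Finset.univ.filter fun v : ZMod p ↦ v ^ 4 = w).card : ℕ) : ℤ[i]) =
      ∑ k ∈ Finset.range 4, chi hp1 hπp w ^ k := by
  classical
  rcases eq_or_ne w 0 with rfl | hw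
  · have : (Finset.univ.filter fun v : ZMod p ↦ v ^ 4 = 0) = {0} := by
      ext v; simp [pow_eq_zero_iff]
    rw [this, MulChar.map_zero]
    simp [Finset.sum_range_succ]
  by_cases h4 : ∃ a : ZMod p, a ^ 4 = w
  · obtain ⟨a, rfl⟩ := h4
    have ha : a ≠ 0 := fun h ↦ hw (by rw [h]; ring)
    rw [map_pow, chi_pow_four hp1 hπp ha]
    have hset : (Finset.univ.filter fun v : ZMod p ↦ v ^ 4 = a ^ 4) =
        ({1, iota π, -1, -iota π} : Finset (ZMod p)).image (a * ·) := by
      ext v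
      simp only [Finset.mem_filter, Finset.mem_univ, true_and, Finset.mem_image]
      constructor
      · intro hv
        refine ⟨v * a⁻¹, ?_, by field_simp⟩
        have hζ : (v * a⁻¹) ^ 4 = 1 := by
          rw [mul_pow, hv, inv_pow, mul_inv_cancel₀ (pow_ne_zero 4 ha)]
        rcases fourth_root_of_unity hπp hζ with h | h | h | h <;> simp [h]
      · rintro ⟨ζ, hζ, rfl⟩
        have hι4 : iota (p := p) π ^ 4 = 1 := by
          rw [show iota (p := p) π ^ 4 = (iota π * iota π) * (iota π * iota π) by ring,
            iota_sq hπp]; ring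
        simp only [Finset.mem_insert, Finset.mem_singleton] at hζ
        rcases hζ with rfl | rfl | rfl | rfl
        · ring
        · rw [mul_pow, hι4, mul_one]
        · ring
        · rw [mul_pow, neg_pow, hι4]; ring
    rw [hset, Finset.card_image_of_injective _ (mul_right_injective₀ ha),
      card_fourth_roots_of_unity hp1 hπp]
    norm_num [Finset.sum_range_succ]
  · have hempty : (Finset.univ.filter fun v : ZMod p ↦ v ^ 4 = w) = ∅ := by
      ext v
      simp only [Finset.mem_filter, Finset.mem_univ, true_and, Finset.notMem_empty, iff_false]
      exact fun hv ↦ h4 ⟨v, hv⟩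
    rw [hempty, Finset.card_empty, Nat.cast_zero]
    have hne : chi hp1 hπp w ≠ 1 := fun h ↦ h4 ((chi_eq_one_iff hp1 hπp hw).mp h)
    have hgeom := geom_sum_mul (chi hp1 hπp w) 4
    rw [chi_pow_four hp1 hπp hw, sub_self] at hgeom
    exact ((mul_eq_zero.mp hgeom).resolve_right (sub_ne_zero.mpr hne)).symm

end Counting

/-! ### The count `#{(u, v) : u² = v⁴ + c}` as a Jacobi sum (Ireland–Rosen, eq. (i), p. 300) -/

section Quartic

variable {π : ℤ[i]}

/-- The quadratic character of `𝔽_p` with values in `ℤ[i]`. [folklore] -/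
def rho (p : ℕ) [Fact p.Prime] : MulChar (ZMod p) ℤ[i] :=
  (quadraticChar (ZMod p)).ringHomComp (Int.castRingHom ℤ[i])

/-- `ρ(t) = (t/p)` cast into `ℤ[i]`. [folklore] -/
theorem rho_apply (t : ZMod p) : rho p t = ((quadraticChar (ZMod p) t : ℤ) : ℤ[i]) := by
  simp [rho, MulChar.ringHomComp_apply]

/-- `ringChar 𝔽_p ≠ 2` for `p ≡ 1 (mod 4)`. [folklore] -/
theorem ringChar_ne_two (hp1 : p % 4 = 1) : ringChar (ZMod p) ≠ 2 := by
  rw [ZMod.ringChar_zmod_n]; intro h; rw [h] at hp1; norm_num at hp1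

/-- **`χ_π² = ρ`** as multiplicative characters. [folklore] -/
theorem chi_sq_eq_rho (hp1 : p % 4 = 1) (hπp : π.norm = p) : chi hp1 hπp ^ 2 = rho p := by
  apply MulChar.ext'
  intro t
  rw [MulChar.pow_apply' _ two_ne_zero, sq, chi_mul_chi hp1 hπp, rho_apply]

/-- `ρ` is nontrivial. [folklore] -/
theorem rho_ne_one (hp1 : p % 4 = 1) : rho p ≠ 1 := by
  obtain ⟨a, ha⟩ := quadraticChar_exists_neg_one (ringChar_ne_two hp1)
  intro h
  have ha0 : IsUnit a := by
    rw [isUnit_iff_ne_zero]; rintro rfl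
    rw [quadraticChar_zero] at ha; norm_num at ha
  have h1 : rho p a = 1 := by
    have := MulChar.one_apply_coe (R' := ℤ[i]) ha0.unit
    rw [IsUnit.unit_spec] at this
    rw [h, this]
  rw [rho_apply, ha] at h1
  norm_num at h1

/-- `ρ(-1) = 1` for `p ≡ 1 (mod 4)`. [folklore] -/
theorem rho_neg_one (hp1 : p % 4 = 1) : rho p (-1) = 1 := by
  classical
  rw [rho_apply, quadraticChar_neg_one (ringChar_ne_two hp1), ZMod.card p, ZMod.χ₄_nat_one_mod_four hp1]
  simp

/-- `ρ(c)² = 1` for `c ≠ 0`. [folklore] -/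
theorem rho_mul_self {c : ZMod p} (hc : c ≠ 0) : rho p c * rho p c = 1 := by
  rw [rho_apply, ← Int.cast_mul, ← sq, quadraticChar_sq_one hc, Int.cast_one]

/-- `J(ρ, ρ) = -1` for `p ≡ 1 (mod 4)` (Ireland–Rosen, Ch. 8 §3, Theorem 1 corollary;
Mathlib's `jacobiSum_nontrivial_inv`). [folklore] -/
theorem jacobiSum_rho_rho (hp1 : p % 4 = 1) : jacobiSum (rho p) (rho p) = -1 := by
  have hq : (rho p).IsQuadratic := (quadraticChar_isQuadratic (ZMod p)).comp _
  have h : jacobiSum (rho p) (rho p)⁻¹ = -(rho p (-1)) := jacobiSum_nontrivial_inv (rho_ne_one hp1)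
  rw [hq.inv] at h
  rw [h, rho_neg_one hp1]

/-- `N' = p + ∑_v ρ(v⁴ + c)`: `#{(u,v) : u² = v⁴ + c} = ∑_v #{u : u² = v⁴ + c} = ∑_v (1 + ρ(v⁴ + c))`
(Mathlib's `quadraticChar_card_sqrts`). [folklore] -/
theorem card_quartic_eq_sum (hp1 : p % 4 = 1) (c : ZMod p) :
    (Fintype.card {uv : ZMod p × ZMod p // uv.1 ^ 2 = uv.2 ^ 4 + c} : ℤ) =
      p + ∑ v : ZMod p, quadraticChar (ZMod p) (v ^ 4 + c) := by
  classical
  have hchar := ringChar_ne_two hp1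
  let e : {uv : ZMod p × ZMod p // uv.1 ^ 2 = uv.2 ^ 4 + c} ≃
      Σ v : ZMod p, {u : ZMod p // u ^ 2 = v ^ 4 + c} :=
    { toFun := fun x ↦ ⟨x.1.2, x.1.1, x.2⟩
      invFun := fun y ↦ ⟨(y.2.1, y.1), y.2.2⟩
      left_inv := fun _ ↦ rfl
      right_inv := fun _ ↦ rfl }
  rw [Fintype.card_congr e, Fintype.card_sigma]
  push_cast
  have hsq : ∀ v : ZMod p, (Fintype.card {u : ZMod p // u ^ 2 = v ^ 4 + c} : ℤ) =
      quadraticChar (ZMod p) (v ^ 4 + c) + 1 := by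
    intro v
    rw [Fintype.card_subtype, ← quadraticChar_card_sqrts hchar (v ^ 4 + c), Set.toFinset_setOf]
  simp_rw [hsq]
  rw [Finset.sum_add_distrib, Finset.sum_const, Finset.card_univ, ZMod.card p, nsmul_eq_mul,
    mul_one]
  ring

/-- `∑_v ρ(v⁴ + c) = ∑_w #{v : v⁴ = w} ρ(w + c)`. [folklore] -/
theorem sum_rho_pow_four_add (c : ZMod p) :
    ∑ v : ZMod p, rho p (v ^ 4 + c) =
      ∑ w : ZMod p, ((Finset.univ.filter fun v : ZMod p ↦ v ^ 4 = w).card : ℤ[i]) * rho p (w + c) := by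
  classical
  rw [← Finset.sum_fiberwise_of_maps_to (g := fun v : ZMod p ↦ v ^ 4) (t := Finset.univ)
    (fun _ _ ↦ Finset.mem_univ _) (fun v : ZMod p ↦ rho p (v ^ 4 + c))]
  refine Finset.sum_congr rfl fun w _ ↦ ?_
  rw [Finset.sum_congr rfl (fun v hv ↦ by rw [(Finset.mem_filter.mp hv).2]), Finset.sum_const,
    nsmul_eq_mul]

/-- `∑_w φ(w) ρ(w + c) = φ(-c) ρ(c) J(φ, ρ)` for `c ≠ 0` (substitute `w = -c a`). [folklore] -/
theorem sum_mul_rho_add {c : ZMod p} (hc : c ≠ 0) (φ : MulChar (ZMod p) ℤ[i]) :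
    ∑ w : ZMod p, φ w * rho p (w + c) = φ (-c) * rho p c * jacobiSum φ (rho p) := by
  have h : ∑ w : ZMod p, φ w * rho p (w + c) = ∑ a : ZMod p, φ (-c * a) * rho p (-c * a + c) :=
    (Equiv.sum_comp (Equiv.mulLeft₀ (-c) (neg_ne_zero.mpr hc)) (fun w ↦ φ w * rho p (w + c))).symm
  rw [h, jacobiSum, Finset.mul_sum]
  refine Finset.sum_congr rfl fun a _ ↦ ?_
  rw [show -c * a + c = c * (1 - a) by ring, map_mul, map_mul]
  ring

/-- `∑_w ρ(w + c) = 0`. [folklore] -/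
theorem sum_rho_add (hp1 : p % 4 = 1) (c : ZMod p) : ∑ w : ZMod p, rho p (w + c) = 0 := by
  exact (Equiv.sum_comp (Equiv.addRight c) (rho p)).trans
    (MulChar.sum_eq_zero_of_ne_one (rho_ne_one hp1))

/-- `χ_π(c)² = ρ(c)`. [folklore] -/
theorem chi_sq (hp1 : p % 4 = 1) (hπp : π.norm = p) (c : ZMod p) :
    chi hp1 hπp c ^ 2 = rho p c := by
  rw [sq, chi_mul_chi hp1 hπp, rho_apply]

/-- `star` fixes the values of `ρ`. [folklore] -/
theorem star_rho (c : ZMod p) : star (rho p c) = rho p c := by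
  rw [rho_apply]; ext <;> simp

/-- `J(χ_π³, ρ) = star J(χ_π, ρ)`. [folklore] -/
theorem jacobiSum_chi_cube (hp1 : p % 4 = 1) (hπp : π.norm = p) :
    jacobiSum (chi hp1 hπp ^ 3) (rho p) = star (jacobiSum (chi hp1 hπp) (rho p)) := by
  simp only [jacobiSum, star_sum, star_mul, star_rho, star_chi hp1 hπp,
    MulChar.pow_apply' _ (by norm_num : (3 : ℕ) ≠ 0)]
  refine Finset.sum_congr rfl fun x _ ↦ ?_
  ring

/-- **`#{(u, v) : u² = v⁴ + c} = p - 1 + T + T̄`, `T = \overline{χ_π(-c)} J(χ_π, ρ)`** for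
`c ≠ 0` (Ireland–Rosen, Ch. 18 §4, eq. (i), PDF p. 300:
`N(u² = v⁴ + 4D) = p - 1 + \overline{λ(-4D)} J(ρ, λ) + λ(-4D) \overline{J(ρ, λ)}`).
[cite: IrelandRosen1990, Ch. 18 §4, eq. (i) (PDF p. 300)] -/
theorem card_quartic (hp1 : p % 4 = 1) (hπp : π.norm = p) {c : ZMod p} (hc : c ≠ 0) :
    (((Fintype.card {uv : ZMod p × ZMod p // uv.1 ^ 2 = uv.2 ^ 4 + c} : ℕ) : ℤ) : ℤ[i]) =
      (p : ℤ[i]) - 1 + star (chi hp1 hπp (-c)) * jacobiSum (chi hp1 hπp) (rho p) +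
        star (star (chi hp1 hπp (-c)) * jacobiSum (chi hp1 hπp) (rho p)) := by
  classical
  set χ := chi hp1 hπp with hχ
  rw [card_quartic_eq_sum hp1, Int.cast_add, Int.cast_natCast, Int.cast_sum]
  have hρ : ∀ v : ZMod p, ((quadraticChar (ZMod p) (v ^ 4 + c) : ℤ) : ℤ[i]) = rho p (v ^ 4 + c) :=
    fun v ↦ (rho_apply _).symm
  simp_rw [hρ]
  rw [sum_rho_pow_four_add]
  simp_rw [card_pow_four_eq hp1 hπp, Finset.sum_range_succ, Finset.sum_range_zero, zero_add,
    pow_zero, add_mul, one_mul, Finset.sum_add_distrib]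
  rw [sum_rho_add hp1 c]
  have e1 := sum_mul_rho_add hc χ
  have e2 := sum_mul_rho_add hc (χ ^ 2)
  have e3 := sum_mul_rho_add hc (χ ^ 3)
  simp only [MulChar.pow_apply' _ two_ne_zero,
    MulChar.pow_apply' _ (by norm_num : (3 : ℕ) ≠ 0)] at e2 e3
  simp only [pow_one]
  rw [e1, e2, e3, chi_sq_eq_rho hp1 hπp, jacobiSum_rho_rho hp1, jacobiSum_chi_cube hp1 hπp]
  -- coefficient identities
  have h1 : χ (-1) * χ (-1) = 1 := chi_neg_one_sq hp1 hπp
  have h4 : χ c ^ 4 = 1 := chi_pow_four hp1 hπp hc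
  have hneg : χ (-c) = χ (-1) * χ c := by rw [← map_mul, neg_one_mul]
  have hρc : rho p c = χ c ^ 2 := (chi_sq hp1 hπp c).symm
  rw [star_mul, star_star, star_chi hp1 hπp, ← hχ, hρc, hneg]
  set x := χ (-1)
  set y := χ c
  set J := jacobiSum χ (rho p)
  linear_combination (-x * y ^ 3 * J - y ^ 4 + x * y * star J * y ^ 4) * h1 +
    (-1 + x * y * star J) * h4

end Quartic

/-! ### Gauss sums: `J(χ_π, ρ) = χ_π(-1) J(χ_π, χ_π)` and `N(J(χ_π, χ_π)) = p` -/

section Gauss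

variable {π : ℤ[i]}

/-- `χ_π` viewed in `ℂ`. [folklore] -/
def chiC (hp1 : p % 4 = 1) (hπp : π.norm = p) : MulChar (ZMod p) ℂ :=
  (chi hp1 hπp).ringHomComp GaussianInt.toComplex

/-- `ρ` viewed in `ℂ`. [folklore] -/
def rhoC (p : ℕ) [Fact p.Prime] : MulChar (ZMod p) ℂ := (rho p).ringHomComp GaussianInt.toComplex

/-- `χ_π(t)` in `ℂ`. [folklore] -/
theorem chiC_apply (hp1 : p % 4 = 1) (hπp : π.norm = p) (t : ZMod p) :
    chiC hp1 hπp t = ((chi hp1 hπp t : ℤ[i]) : ℂ) := rfl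

/-- `ρ(t)` in `ℂ`. [folklore] -/
theorem rhoC_apply (t : ZMod p) : rhoC p t = ((rho p t : ℤ[i]) : ℂ) := rfl

/-- `χ_π⁴ = 1`. [folklore] -/
theorem chiC_pow_four (hp1 : p % 4 = 1) (hπp : π.norm = p) : chiC hp1 hπp ^ 4 = 1 := by
  apply MulChar.ext
  intro u
  rw [MulChar.pow_apply_coe, MulChar.one_apply_coe, chiC_apply, ← map_pow,
    chi_pow_four hp1 hπp u.ne_zero, map_one]

/-- `χ_π⁻¹ = χ_π³`. [folklore] -/
theorem chiC_inv (hp1 : p % 4 = 1) (hπp : π.norm = p) : (chiC hp1 hπp)⁻¹ = chiC hp1 hπp ^ 3 := by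
  refine (inv_eq_of_mul_eq_one_right ?_)
  rw [← pow_succ', chiC_pow_four hp1 hπp]

/-- `χ_π² = ρ` in `ℂ`. [folklore] -/
theorem chiC_sq (hp1 : p % 4 = 1) (hπp : π.norm = p) : chiC hp1 hπp * chiC hp1 hπp = rhoC p := by
  rw [← sq, chiC, MulChar.ringHomComp_pow, chi_sq_eq_rho hp1 hπp]; rfl

/-- `χ_π ρ = χ_π³`. [folklore] -/
theorem chiC_mul_rhoC (hp1 : p % 4 = 1) (hπp : π.norm = p) :
    chiC hp1 hπp * rhoC p = chiC hp1 hπp ^ 3 := by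
  rw [← chiC_sq hp1 hπp, pow_succ, sq]
  exact (mul_assoc _ _ _).symm

/-- `χ_π`, `χ_π²`, `χ_π³` are nontrivial. [folklore] -/
theorem chiC_ne_one (hp1 : p % 4 = 1) (hπp : π.norm = p) :
    chiC hp1 hπp ≠ 1 ∧ chiC hp1 hπp * chiC hp1 hπp ≠ 1 ∧ chiC hp1 hπp ^ 3 ≠ 1 := by
  obtain ⟨t, ht⟩ := exists_chi_eq_I hp1 hπp
  have ht0 : t ≠ 0 := by rintro rfl; rw [MulChar.map_zero] at ht; exact absurd ht (by decide)
  have htu : IsUnit t := isUnit_iff_ne_zero.mpr ht0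
  have h1 : chiC hp1 hπp t = Complex.I := by
    rw [chiC_apply, ht, GaussianInt.toComplex_def']; simp
  have hone : ∀ φ : MulChar (ZMod p) ℂ, φ = 1 → φ t = 1 := by
    rintro φ rfl
    have := MulChar.one_apply_coe (R' := ℂ) htu.unit
    rwa [IsUnit.unit_spec] at this
  have hre : ∀ z : ℂ, z = 1 → z.re = 1 := by rintro z rfl; rfl
  refine ⟨fun h ↦ ?_, fun h ↦ ?_, fun h ↦ ?_⟩
  · have := hre _ (hone _ h); rw [h1] at this; simp at this
  · have := hone _ h
    rw [MulChar.mul_apply, h1, Complex.I_mul_I] at this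
    norm_num at this
  · have := hre _ (hone _ h)
    rw [MulChar.pow_apply' _ (by norm_num : (3 : ℕ) ≠ 0), h1] at this
    simp [pow_succ, Complex.I_mul_I] at this

/-- `ρ` in `ℂ` is a nontrivial quadratic character with `ρ(-1) = 1`. [folklore] -/
theorem rhoC_props (hp1 : p % 4 = 1) (hπp : π.norm = p) :
    rhoC p ≠ 1 ∧ (rhoC p).IsQuadratic ∧ rhoC p (-1) = 1 := by
  refine ⟨?_, ((quadraticChar_isQuadratic (ZMod p)).comp _).comp _, ?_⟩
  · rw [← chiC_sq hp1 hπp]; exact (chiC_ne_one hp1 hπp).2.1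
  · rw [rhoC_apply, rho_neg_one hp1, map_one]

/-- **`J(χ_π, ρ) = χ_π(-1) J(χ_π, χ_π)`** (Ireland–Rosen, Prop. 9.9.1, equivalently the Lemma of
Ch. 18 §3, `J(ρ, λ) = λ(4) J(λ, λ)`: both Jacobi sums are quotients of the Gauss sums
`g(χ_π)`, `g(ρ)`, `g(χ_π³)` with `g(ρ)² = p` and `g(χ_π) g(χ_π³) = χ_π(-1) p`; Mathlib's
`jacobiSum_mul_nontrivial`, `gaussSum_sq`, `gaussSum_mul_gaussSum_eq_card`).
[cite: IrelandRosen1990, Ch. 9 §9, Prop. 9.9.1 (PDF p. 130)] -/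
theorem jacobiSum_chi_rho (hp1 : p % 4 = 1) (hπp : π.norm = p) :
    jacobiSum (chi hp1 hπp) (rho p) = chi hp1 hπp (-1) * jacobiSum (chi hp1 hπp) (chi hp1 hπp) := by
  apply GaussianInt.toComplex_injective
  rw [map_mul, ← jacobiSum_ringHomComp, ← jacobiSum_ringHomComp]
  change jacobiSum (chiC hp1 hπp) (rhoC p) = chiC hp1 hπp (-1) * jacobiSum (chiC hp1 hπp) (chiC hp1 hπp)
  obtain ⟨hne1, hne2, hne3⟩ := chiC_ne_one hp1 hπp
  obtain ⟨hρ1, hρq, hρm1⟩ := rhoC_props hp1 hπp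
  haveI : NeZero p := ⟨hp.out.ne_zero⟩
  set ψ := ZMod.stdAddChar (N := p) with hψdef
  have hψ : ψ.IsPrimitive := ZMod.isPrimitive_stdAddChar p
  set χ := chiC hp1 hπp with hχ
  have hcard : (Fintype.card (ZMod p) : ℂ) = p := by rw [ZMod.card]
  have hcard0 : (Fintype.card (ZMod p) : ℂ) ≠ 0 := by
    rw [hcard]; exact_mod_cast hp.out.ne_zero
  have b1 : gaussSum (rhoC p) ψ * jacobiSum χ χ = gaussSum χ ψ * gaussSum χ ψ := by
    rw [← chiC_sq hp1 hπp]; exact jacobiSum_mul_nontrivial hne2 ψ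
  have b2 : gaussSum (χ ^ 3) ψ * jacobiSum χ (rhoC p) = gaussSum χ ψ * gaussSum (rhoC p) ψ := by
    rw [← chiC_mul_rhoC hp1 hπp]
    exact jacobiSum_mul_nontrivial (by rw [chiC_mul_rhoC hp1 hπp]; exact hne3) ψ
  have b3 : gaussSum (rhoC p) ψ ^ 2 = p := by
    rw [gaussSum_sq hρ1 hρq hψ, hρm1, one_mul, hcard]
  have hx : χ (-1) * χ (-1) = 1 := by
    rw [hχ, chiC_apply, ← map_mul, chi_neg_one_sq hp1 hπp, map_one]
  have b4 : gaussSum χ ψ * gaussSum (χ ^ 3) ψ = χ (-1) * p := by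
    have h := gaussSum_mul_gaussSum_eq_card hne1 hψ
    have h' := mul_gaussSum_inv_eq_gaussSum χ⁻¹ ψ
    rw [hχ, chiC_inv hp1 hπp, ← hχ] at h h'
    rw [MulChar.pow_apply' _ (by norm_num : (3 : ℕ) ≠ 0)] at h'
    have hx3 : χ (-1) ^ 3 = χ (-1) := by
      rw [pow_succ, sq, hx, one_mul]
    rw [hx3] at h'
    calc gaussSum χ ψ * gaussSum (χ ^ 3) ψ
        = χ (-1) * (gaussSum χ ψ * gaussSum (χ ^ 3) ψ⁻¹) := by rw [← h']; ring
      _ = χ (-1) * p := by rw [h, hcard]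
  have hg2 : gaussSum (rhoC p) ψ ≠ 0 := gaussSum_ne_zero_of_nontrivial hcard0 hρ1 hψ
  have hg3 : gaussSum (χ ^ 3) ψ ≠ 0 := gaussSum_ne_zero_of_nontrivial hcard0 hne3 hψ
  apply mul_left_cancel₀ (mul_ne_zero hg2 hg3)
  set g1 := gaussSum χ ψ
  set g2 := gaussSum (rhoC p) ψ
  set g3 := gaussSum (χ ^ 3) ψ
  set x := χ (-1)
  linear_combination g2 * b2 + g1 * b3 - x * g3 * b1 - x * g1 * b4 - g1 * (p : ℂ) * hx

/-- **`N(J(χ_π, χ_π)) = p`** (Ireland–Rosen, Ch. 8 §3, Corollary to Theorem 1; Mathlib's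
`jacobiSum_mul_jacobiSum_inv` in `ℂ` with `J(χ̄, χ̄) = \overline{J(χ, χ)}`). [folklore] -/
theorem norm_jacobiSum_chi_chi (hp1 : p % 4 = 1) (hπp : π.norm = p) :
    (jacobiSum (chi hp1 hπp) (chi hp1 hπp)).norm = p := by
  obtain ⟨hne1, hne2, -⟩ := chiC_ne_one hp1 hπp
  have hchar : ringChar ℂ ≠ ringChar (ZMod p) := by
    rw [ringChar.eq_iff.mpr (inferInstance : CharP ℂ 0), ZMod.ringChar_zmod_n]
    exact hp.out.ne_zero.symm
  have key := jacobiSum_mul_jacobiSum_inv hchar hne1 hne1 hne2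
  rw [chiC_inv hp1 hπp] at key
  have hstar : jacobiSum (chi hp1 hπp ^ 3) (chi hp1 hπp ^ 3) =
      star (jacobiSum (chi hp1 hπp) (chi hp1 hπp)) := by
    simp only [jacobiSum, star_sum, star_mul, star_chi hp1 hπp,
      MulChar.pow_apply' _ (by norm_num : (3 : ℕ) ≠ 0)]
    exact Finset.sum_congr rfl fun x _ ↦ mul_comm _ _
  have e1 : jacobiSum (chiC hp1 hπp) (chiC hp1 hπp) =
      ((jacobiSum (chi hp1 hπp) (chi hp1 hπp) : ℤ[i]) : ℂ) := jacobiSum_ringHomComp _ _ _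
  have e3 : jacobiSum (chiC hp1 hπp ^ 3) (chiC hp1 hπp ^ 3) =
      ((jacobiSum (chi hp1 hπp ^ 3) (chi hp1 hπp ^ 3) : ℤ[i]) : ℂ) := by
    rw [chiC, MulChar.ringHomComp_pow]; exact jacobiSum_ringHomComp _ _ _
  rw [e1, e3, hstar, GaussianInt.toComplex_star, ZMod.card, mul_comm,
    ← Complex.normSq_eq_conj_mul_self, ← GaussianInt.intCast_complex_norm] at key
  exact_mod_cast key

end Gauss

/-! ### `-χ_π(-1) J(χ_π, χ_π) = π` (Ireland–Rosen, Props. 9.9.3–9.9.4) -/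

section Primary

variable {π : ℤ[i]}

/-- `φ_π(χ_π(t)) = t^{(p-1)/4}` for every `t` (also `t = 0`). [folklore] -/
theorem red_chi' (hp1 : p % 4 = 1) (hπp : π.norm = p) (t : ZMod p) :
    red hπp (chi hp1 hπp t) = t ^ (p / 4) := by
  rcases eq_or_ne t 0 with rfl | ht
  · have := five_le hp1
    rw [MulChar.map_zero, map_zero, zero_pow (by omega)]
  · exact red_chi hp1 hπp ht

/-- **`π ∣ J(χ_π, χ_π)`** (Ireland–Rosen, proof of Prop. 9.9.4:
`J(χ_π, χ_π) ≡ ∑_t t^{(p-1)/4} (1-t)^{(p-1)/4} ≡ 0 (π)`, the power sums `∑_t t^e`, `0 ≤ e < p - 1`,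
vanishing in `𝔽_p` — "Exercise 11 of Chapter 4"). [cite: IrelandRosen1990, Ch. 9 §9, proof of Prop. 9.9.4 (PDF p. 131)] -/
theorem dvd_jacobiSum_chi_chi (hp1 : p % 4 = 1) (hπp : π.norm = p) :
    π ∣ jacobiSum (chi hp1 hπp) (chi hp1 hπp) := by
  apply dvd_of_red_eq_zero hπp
  rw [jacobiSum, map_sum]
  simp_rw [map_mul, red_chi' hp1 hπp]
  set m := p / 4 with hm
  have h5 := five_le hp1
  have hexp : ∀ t : ZMod p, t ^ m * (1 - t) ^ m =
      ∑ k ∈ Finset.range (m + 1), ((-1 : ZMod p) ^ (m - k) * m.choose k) * t ^ (2 * m - k) := by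
    intro t
    rw [sub_eq_add_neg, add_pow, Finset.mul_sum]
    refine Finset.sum_congr rfl fun k hk ↦ ?_
    rw [Finset.mem_range] at hk
    rw [one_pow, one_mul, neg_pow, show 2 * m - k = m + (m - k) by omega, pow_add]
    ring
  simp_rw [hexp]
  rw [Finset.sum_comm]
  refine Finset.sum_eq_zero fun k hk ↦ ?_
  rw [Finset.mem_range] at hk
  rw [← Finset.mul_sum, FiniteField.sum_pow_lt_card_sub_one (K := ZMod p) (i := 2 * m - k) ?_,
    mul_zero]
  rw [ZMod.card]
  omega

/-- `2 (u - 1) ∈ (2 + 2i)` for every unit `u` ("any unit is `≡ 1 (mod 1 + i)`", Ireland–Rosen,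
proof of Prop. 9.9.3). [folklore] -/
theorem dvd_two_mul_sub_one {u : ℤ[i]} (hu : IsUnit u) : (⟨2, 2⟩ : ℤ[i]) ∣ 2 * (u - 1) := by
  rcases eq_of_isUnit hu with rfl | rfl | rfl | rfl
  · simp
  · exact ⟨⟨-1, 1⟩, by decide⟩
  · exact ⟨⟨0, 1⟩, by decide⟩
  · exact ⟨-1, by decide⟩

/-- `χ_π(2⁻¹)² = χ_π(-1)`. [folklore] -/
theorem chi_inv_two_sq (hp1 : p % 4 = 1) (hπp : π.norm = p) :
    chi hp1 hπp 2⁻¹ * chi hp1 hπp 2⁻¹ = chi hp1 hπp (-1) := by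
  have h2 : (2 : ZMod p) ≠ 0 := two_ne_zero_of_one_mod_four hp1
  have h4 : (2⁻¹ : ZMod p) * 2⁻¹ * 4 = 1 := by
    rw [show (4 : ZMod p) = 2 * 2 by norm_num]; field_simp
  have hx := chi_neg_one_sq hp1 hπp
  have := congrArg (chi hp1 hπp) h4
  rw [map_mul, map_mul, map_one, ← chi_neg_one_eq_chi_four hp1 hπp] at this
  calc chi hp1 hπp 2⁻¹ * chi hp1 hπp 2⁻¹
      = chi hp1 hπp 2⁻¹ * chi hp1 hπp 2⁻¹ * (chi hp1 hπp (-1) * chi hp1 hπp (-1)) := by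
        rw [hx, mul_one]
    _ = chi hp1 hπp (-1) := by rw [← mul_assoc, this, one_mul]

/-- **`-χ_π(-1) J(χ_π, χ_π)` is primary** (Ireland–Rosen, Prop. 9.9.3: pairing `t ↔ 1 - t` in
`J = ∑_t χ(t) χ(1-t)` gives `J ≡ 2·(p-3)/2 + χ(2⁻¹)² ≡ -2 + χ(-1) (mod 2 + 2i)`, as `2u ≡ 2` for
units `u` and `p ≡ 1`). [cite: IrelandRosen1990, Ch. 9 §9, Prop. 9.9.3 (PDF pp. 130–131)] -/
theorem isPrimary_neg_mul_jacobiSum (hp1 : p % 4 = 1) (hπp : π.norm = p) :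
    IsPrimary (-(chi hp1 hπp (-1) * jacobiSum (chi hp1 hπp) (chi hp1 hπp))) := by
  classical
  rw [isPrimary_iff_dvd, ← Ideal.mem_span_singleton, ← Ideal.Quotient.eq_zero_iff_mem]
  set I : Ideal ℤ[i] := Ideal.span {(⟨2, 2⟩ : ℤ[i])} with hI
  set χ := chi hp1 hπp with hχ
  set x : ℤ[i] := χ (-1) with hxdef
  have hmem : ∀ {z : ℤ[i]}, (⟨2, 2⟩ : ℤ[i]) ∣ z → Ideal.Quotient.mk I z = 0 := fun h ↦
    Ideal.Quotient.eq_zero_iff_mem.mpr (Ideal.mem_span_singleton.mpr h)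
  have hunit : ∀ {u : ℤ[i]}, IsUnit u → Ideal.Quotient.mk I (2 * (u - 1)) = 0 := fun hu ↦
    hmem (dvd_two_mul_sub_one hu)
  have h4 : Ideal.Quotient.mk I 4 = 0 := hmem ⟨⟨1, -1⟩, by decide⟩
  -- the element `h = 2⁻¹` and the three exceptional points `0, 1, h`
  have h2 : (2 : ZMod p) ≠ 0 := two_ne_zero_of_one_mod_four hp1
  set h : ZMod p := 2⁻¹ with hh
  have hh2 : h * 2 = 1 := inv_mul_cancel₀ h2
  have hh0 : h ≠ 0 := inv_ne_zero h2
  have hh1 : h ≠ 1 := by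
    intro e; rw [e, one_mul] at hh2; apply h2; linear_combination 2 * hh2
  have h1h : 1 - h = h := by linear_combination -hh2
  -- the summand
  set g : ZMod p → ℤ[i] := fun t ↦ χ t * χ (1 - t) with hg
  have hg0 : g 0 = 0 := by simp [hg, MulChar.map_zero]
  have hg1 : g 1 = 0 := by simp [hg, MulChar.map_zero]
  have hgh : g h = x := by
    simp only [hg]; rw [h1h, hh, chi_inv_two_sq hp1 hπp]
  have hg_unit : ∀ t : ZMod p, t ≠ 0 → t ≠ 1 → IsUnit (g t) := fun t ht0 ht1 ↦
    (isUnit_chi hp1 hπp ht0).mul (isUnit_chi hp1 hπp (sub_ne_zero.mpr (Ne.symm ht1)))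
  -- split the Jacobi sum
  set A : Finset (ZMod p) := ((Finset.univ \ {h}) \ {0}) \ {1} with hA
  have hsum : jacobiSum χ χ = ∑ t ∈ A, g t + x := by
    rw [jacobiSum]
    change ∑ t, g t = _
    rw [Finset.sum_eq_sum_sdiff_singleton_add (Finset.mem_univ h) g,
      Finset.sum_eq_sum_sdiff_singleton_add (i := (0 : ZMod p)) (by simp [hh0.symm]) g,
      Finset.sum_eq_sum_sdiff_singleton_add (i := (1 : ZMod p)) (by simp [hh1.symm]) g,
      hg0, hg1, hgh, add_zero, add_zero]
  have hA_mem : ∀ t : ZMod p, t ∈ A ↔ t ≠ h ∧ t ≠ 0 ∧ t ≠ 1 := fun t ↦ by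
    simp [hA, and_assoc]
  have hA_card : A.card = p - 3 := by
    have e1 : ((Finset.univ \ {h}) \ {0} : Finset (ZMod p)).card = p - 2 := by
      rw [Finset.card_sdiff_of_subset (by simp [hh0.symm]), Finset.card_sdiff_of_subset (by simp),
        Finset.card_univ, ZMod.card, Finset.card_singleton, Finset.card_singleton]
      omega
    rw [hA, Finset.card_sdiff_of_subset (by simp [hh1.symm]), e1, Finset.card_singleton]
    omega
  -- the involution `t ↦ 1 - t` on `A` kills `∑ (g t - 1)` modulo `(2 + 2i)`
  have hinv : ∑ t ∈ A, Ideal.Quotient.mk I (g t - 1) = 0 := by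
    refine Finset.sum_involution (fun t _ ↦ 1 - t) ?_ ?_ ?_ ?_
    · intro t ht
      obtain ⟨-, ht0, ht1⟩ := (hA_mem t).mp ht
      have hsym : g (1 - t) = g t := by simp only [hg, sub_sub_cancel]; ring
      rw [hsym, ← map_add, show g t - 1 + (g t - 1) = 2 * (g t - 1) by ring]
      exact hunit (hg_unit t ht0 ht1)
    · intro t ht _
      obtain ⟨hth, -, -⟩ := (hA_mem t).mp ht
      intro e
      apply hth
      linear_combination (-h) * e + (-t) * hh2
    · intro t ht
      obtain ⟨hth, ht0, ht1⟩ := (hA_mem t).mp ht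
      rw [hA_mem]
      refine ⟨fun e ↦ hth ?_, sub_ne_zero.mpr (Ne.symm ht1), fun e ↦ ht0 ?_⟩
      · linear_combination -e + h1h
      · linear_combination -e
    · intro t ht
      ring
  have hmkA : Ideal.Quotient.mk I (∑ t ∈ A, g t) = ((p - 3 : ℕ) : ℤ[i] ⧸ I) := by
    rw [map_sum]
    have : ∀ t ∈ A, Ideal.Quotient.mk I (g t) = Ideal.Quotient.mk I (g t - 1) + 1 := fun t _ ↦ by
      rw [map_sub, map_one, sub_add_cancel]
    rw [Finset.sum_congr rfl this, Finset.sum_add_distrib, hinv, zero_add, Finset.sum_const,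
      hA_card, nsmul_eq_mul, mul_one]
  -- assemble
  have h5 := five_le hp1
  have h4' : (4 : ℤ[i] ⧸ I) = 0 := by rw [← h4, map_ofNat]
  have hp3 : ((p - 3 : ℕ) : ℤ[i] ⧸ I) = -2 := by
    have : p - 3 = 4 * (p / 4 - 1) + 2 := by omega
    rw [this]
    push_cast
    linear_combination (((p / 4 - 1 : ℕ) : ℤ[i] ⧸ I) + 1) * h4'
  have hx2 : x * x = 1 := chi_neg_one_sq hp1 hπp
  have hxu : IsUnit x := isUnit_chi hp1 hπp (neg_ne_zero.mpr one_ne_zero)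
  have hx1 : (2 : ℤ[i] ⧸ I) * (Ideal.Quotient.mk I x - 1) = 0 := by
    have := hunit hxu
    rwa [map_mul, map_sub, map_one, map_ofNat] at this
  have hx2' : Ideal.Quotient.mk I x * Ideal.Quotient.mk I x = 1 := by
    rw [← map_mul, hx2, map_one]
  rw [hsum, map_sub, map_neg, map_mul, map_add, map_one, hmkA, hp3]
  set y := Ideal.Quotient.mk I x
  linear_combination hx1 - hx2'

/-- **Ireland–Rosen, Prop. 9.9.4: `-χ_π(-1) J(χ_π, χ_π) = π`** for `π` primary with `N(π) = p`
(`π ∣ J`, `N(J) = p`, so `J = u π`; `-χ_π(-1) J` and `π` are both primary, so the unit is `1`).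
[cite: IrelandRosen1990, Ch. 9 §9, Prop. 9.9.4 (PDF p. 131)] -/
theorem neg_mul_jacobiSum_eq (hp1 : p % 4 = 1) (hπp : π.norm = p) (hπ : IsPrimary π) :
    -(chi hp1 hπp (-1) * jacobiSum (chi hp1 hπp) (chi hp1 hπp)) = π := by
  obtain ⟨w, hw⟩ := dvd_jacobiSum_chi_chi hp1 hπp
  have hN := norm_jacobiSum_chi_chi hp1 hπp
  rw [hw, Zsqrtd.norm_mul, hπp] at hN
  have hp0 : (p : ℤ) ≠ 0 := by exact_mod_cast hp.out.ne_zero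
  have hw1 : w.norm = 1 := by
    apply mul_left_cancel₀ hp0
    rw [hN, mul_one]
  have hwu : IsUnit w := (Zsqrtd.norm_eq_one_iff' (by norm_num) w).mp hw1
  have hxu : IsUnit (chi hp1 hπp (-1)) := isUnit_chi hp1 hπp (neg_ne_zero.mpr one_ne_zero)
  have hprim := isPrimary_neg_mul_jacobiSum hp1 hπp
  rw [hw, show -(chi hp1 hπp (-1) * (π * w)) = (-(chi hp1 hπp (-1) * w)) * π by ring] at hprim ⊢
  rw [hπ.eq_one_of_isUnit (hxu.mul hwu).neg hprim, one_mul]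

/-- **`J(χ_π, ρ) = -π`** (`= χ_π(-1) J(χ_π, χ_π)` and Prop. 9.9.4). [folklore] -/
theorem jacobiSum_chi_rho_eq (hp1 : p % 4 = 1) (hπp : π.norm = p) (hπ : IsPrimary π) :
    jacobiSum (chi hp1 hπp) (rho p) = -π := by
  rw [jacobiSum_chi_rho hp1 hπp]
  have h := neg_mul_jacobiSum_eq hp1 hπp hπ
  linear_combination -h

end Primary

end GaussianQuartic

/-! ### Discharge of the named fact `IrelandRosen1990_card_points_one_mod_four` -/

section Fact

local notation "ℤ[i]" => GaussianInt

open QuadraticFields.GaussianPrimary GaussianQuartic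

/-- **Ireland–Rosen, Ch. 18 §4, Theorem 5, second assertion — proved.** For `p ≡ 1 (mod 4)`,
`p ∤ D`, `p = N(π)` with `π ≡ 1 (2 + 2i)` and `π ∣ D^{(p-1)/4} - i^k` (i.e. `(D/π)₄ = i^k`), the
curve `y² = x³ - D x` over `𝔽_p` has `N_p = p + 1 - \overline{(D/π)₄} π - (D/π)₄ π̄ =
p + 1 - 2 Re(\overline{i^k} π)` points. Proof as printed (PDF pp. 300–301): `N_p = 2 + N(u² = v⁴ + 4D)`
(`IrelandRosen1990_card_points_eq_card_quartic_add_two`), `N(u² = v⁴ + 4D) = p - 1 +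
\overline{χ(-4D)} J(χ, ρ) + χ(-4D) \overline{J(χ, ρ)}` (`GaussianQuartic.card_quartic`, eq. (i)),
`χ(-4D) = χ(D) = i^k` (`chi_neg_four`, `chi_intCast_eq_I_pow`) and `J(χ, ρ) = χ(-1) J(χ, χ) = -π`
(Props. 9.9.1, 9.9.3, 9.9.4: `jacobiSum_chi_rho_eq`).
[cite: IrelandRosen1990, Ch. 18 §4, Theorem 5 (PDF p. 301), second assertion] -/
theorem IrelandRosen1990_card_points_one_mod_four_holds : IrelandRosen1990_card_points_one_mod_four := by
  intro p _ hp1 D hD π hπp hπ1 k hk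
  have hπ : IsPrimary π := (isPrimary_iff_dvd π).mpr hπ1
  have h2 : (2 : ZMod p) ≠ 0 := two_ne_zero_of_one_mod_four hp1
  have hD0 : ((D : ℤ) : ZMod p) ≠ 0 := by rwa [Ne, ZMod.intCast_zmod_eq_zero_iff_dvd]
  have hc : (4 : ZMod p) * (D : ZMod p) ≠ 0 := by
    refine mul_ne_zero ?_ hD0
    rw [show (4 : ZMod p) = 2 * 2 by norm_num]; exact mul_ne_zero h2 h2
  rw [IrelandRosen1990_card_points_eq_card_quartic_add_two h2 hD0]
  have hN := card_quartic hp1 hπp hc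
  rw [show -(4 * (D : ZMod p)) = -4 * (D : ZMod p) by ring, map_mul, chi_neg_four hp1 hπp, one_mul,
    chi_intCast_eq_I_pow hp1 hπp hD hk, jacobiSum_chi_rho_eq hp1 hπp hπ] at hN
  -- take real parts (generalising the count to dodge instance bookkeeping)
  suffices key : ∀ N : ℕ, (((N : ℤ) : ℤ[i])) = (p : ℤ[i]) - 1 + star ((⟨0, 1⟩ : ℤ[i]) ^ k) * -π +
      star (star ((⟨0, 1⟩ : ℤ[i]) ^ k) * -π) →
      ((N + 2 : ℕ) : ℤ) = p + 1 - 2 * (star ((⟨0, 1⟩ : ℤ[i]) ^ k) * π).re by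
    refine key _ ?_
    convert hN using 3
    exact @Fintype.card_congr _ _ (_) (_) (Equiv.refl _)
  intro N hN'
  have hre := congrArg Zsqrtd.re hN'
  simp only [Zsqrtd.re_intCast, Zsqrtd.re_add, Zsqrtd.re_sub, Zsqrtd.re_natCast, Zsqrtd.re_one,
    Zsqrtd.re_star, Zsqrtd.re_neg, Zsqrtd.im_neg, Zsqrtd.re_mul, Zsqrtd.im_star] at hre
  simp only [Zsqrtd.re_mul, Zsqrtd.re_star, Zsqrtd.im_star]
  push_cast
  linear_combination hre

end Fact

end Literature.NumberTheory.EllipticCurves
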